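import Literature.NumberTheory.EllipticCurves.BSDAnalyticRankTunnellWaldspurgerLValuesProofs
import HarnessLib

/-!
# The finite formula for `Θ-L_{qM′}(Ψ′·Φ)(1)` split by the Chinese remainder theorem `ℤ[i]/qM′ = ℤ[i]/M′ × ℤ[i]/q`
# — the PRIME-GENERIC core of the `p = 3` file `…InertBadAtThreeQuarticFiniteFormulaCRT` (there `q = 3`)

Summit `BirchSwinnertonDyer`, crux `ManinDatumSupercuspidalCMInert` (stmt-BirchSwinnertonDyer-20111, BED r605), registered stubs `stub_S5` /
`stub_S7` (skeleton 9438078f). Width seat bsd-wall-cm-bed-w3 g9 (`--supports 20111`, helper; DICTIONARY LANE of the Kato-fact-free reshaping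
PLAIN-ODD-57: bed-w4 g10 E-side lever p634645/p634975, bed-w2 g10 model lane, this seat's `quarticCharMod` p635076 and
`QuarticTwist.lSeries_twist_eq_thetaLFunction_inert`). After the theta dictionary at level `q·M′` (the inert prime `q ∣ A` of `y² = x³ + Ax`
split off the coefficient as `\overline{(·/q)₄}^k`, `(q, M′) = 1`), the value `Θ-L_{qM′}(Φ·Ψ′)(1)` is a class sum modulo `qM′`
(`GaussianLattice.thetaLFunction_one_eq_sum_kroneckerE₁`, Rubin LNM 1716 Prop. 7.15 at `k = 1`); the Chinese remainder theorem regroups it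
into INNER SUMS OVER THE `q`-DIVISION CLASSES at base points of order dividing `M′` — the objects whose `q`-adic valuations are the CM-side
residual `H₇` (`q = 7`; memo `Cruxes/ManinDatumSupercuspidalCMInert/PLAIN-ODD-57-w4g10.md` §3). This file is bed-w3 g8's
`…InertBadAtThreeQuarticFiniteFormulaCRT` §1/§3 (p630128) with `3 ↦ q` (any `q` coprime to `M′`; the proofs are unchanged), plus one new
generic step:

* `sum_classes_crt` — for `q·e − M′·f = 1`, `Ψ′` periodic mod `M′`, `Φ` periodic mod `q`:
  `Σ_{c mod qM′} Ψ′(c)Φ(c)·E₁*(c̄/(qM′)) = Σ_{a mod M′} Ψ′(a) · Σ_{b mod q} Φ(b)·E₁*(e·ā/M′ − f·b̄/q)`;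
* `exists_mul_sub_mul_eq_one` (Bézout), `not_dvd_of_bezout` (`q ∤ f`), `isCoprime_of_bezout`, `periodic_mul`;
* `thetaLFunction_one_crt` — `Θ-L_{qM′}(Ψ′Φ)(1) = (qM′)⁻¹ Σ_{a mod M′} Ψ′(a) Σ_{b mod q} Φ(b)E₁*(e·ā/M′ − f·b̄/q)`;
* ★ `sum_qClasses_absorb` — if moreover `Φ(f·x) = Φ(x)` (e.g. `Φ = \overline{(·/q)₄}^k`: a RATIONAL integer prime to `q` has `(f/q)₄ = 1`,
  `GaussianQuarticSymbol.quarticCharMod_natCast_intCast`), the Bézout coefficient disappears from the inner sum: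
  `Σ_{b mod q} Φ(b)E₁*(w − f·b̄/q) = Σ_{b mod q} Φ(b)E₁*(w − b̄/q)` (re-index `b ↦ f·b`, a permutation of `(ℤ/q)²`; `E₁*` is `Λ`-periodic) —
  at `q = 3` this replaces the case analysis `f ≡ ±1 (mod 3)` of `…QuarticCleanAssemblyCRT.inner_sum`;
* `thetaLFunction_one_crt_absorb` — the finite formula with the clean inner sums `T_Φ(w_a) = Σ_{b mod q} Φ(b)E₁*(w_a − b̄/q)`, `w_a = e·ā/M′`
  (`M′·w_a ∈ Λ`: the landed `…InertBadAtThreeQuarticFiniteFormulaCRT.natCast_mul_basePoint_mem`, already `q`-free).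

HONEST FRAMING: pure bookkeeping on the Gaussian lattice `ℤi + ℤ`; nothing here proves `stub_S7`, the crux or BSD — the `q`-adic valuation
of the inner sums `T_Φ(w)` (`q = 7`, `Φ = \overline{(·/7)₄}^k`: `v₇ ≥ 1 − k/4`, a tame-resolvent count in `ℚ₇(i)(E₀[7])`) is the open CM-side brick.
No definition, no named fact, no `sorry`; axioms standard.
-/

set_option autoImplicit false
-- the summit namespace `Summit.BirchSwinnertonDyer.BirchSwinnertonDyer.…` (summit = problem) trips `dupNamespace` on every declaration
set_option linter.dupNamespace false

noncomputable section

open UpperHalfPlane hiding I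
open Complex Real PeriodPair
open Literature.NumberTheory.LFunctions.GaussianTheta
open Literature.NumberTheory.EllipticCurves Literature.NumberTheory.EllipticCurves.GaussianLattice
open scoped ComplexConjugate

namespace Summit.BirchSwinnertonDyer.BirchSwinnertonDyer.Theorems.BiquadraticEisensteinDescentManinDatumSupercuspidalCMInertFiniteFormulaCRT

/-! ## §1 The CRT split of a class sum modulo `qM′` -/

section CRT

variable (M' q : ℕ) [NeZero M'] [NeZero q] [NeZero (M' * q)]

/-- ★ **CRT split.** For `gcd(M′, q) = 1`, `Ψ′` periodic modulo `M′`, `Φ` periodic modulo `q`, and integers `e, f` with `q·e − M′·f = 1`: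
`Σ_{c mod qM′} Ψ′(c)Φ(c)E₁*(conj(c/(qM′))) = Σ_{a mod M′} Ψ′(a) Σ_{b mod q} Φ(b) E₁*(e·conj(a)/M′ − f·conj(b)/q)` (canonical representatives;
`c ↔ (c mod M′, c mod q)`, `c = qe·c − M′f·c`, `E₁*` is `ℤi + ℤ`-periodic). The case `q = 3` is
`…InertBadAtThreeQuarticFiniteFormulaCRT.sum_classes_crt`. [folklore] -/
theorem sum_classes_crt (hc : M'.Coprime q) {Ψ' Φ : GaussianInt → ℂ}
    (hΨ : ∀ x y : GaussianInt, Ψ' (x + M' * y) = Ψ' x) (hΦ : ∀ x y : GaussianInt, Φ (x + q * y) = Φ x)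
    {e f : ℤ} (hef : q * e - M' * f = 1) :
    ∑ c : ZMod (M' * q) × ZMod (M' * q),
        Ψ' (rep (M' * q) c 0) * Φ (rep (M' * q) c 0) * kroneckerE₁ (conj (classDiv (M' * q) c)) =
      ∑ a : ZMod M' × ZMod M', Ψ' (rep M' a 0) *
        ∑ b : ZMod q × ZMod q, Φ (rep q b 0) *
          kroneckerE₁ (e * conj ((rep M' a 0 : GaussianInt) : ℂ) / M' - f * conj ((rep q b 0 : GaussianInt) : ℂ) / q) := by
  have hM0 : (M' : ℂ) ≠ 0 := Nat.cast_ne_zero.mpr (NeZero.ne M')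
  have hq0 : (q : ℂ) ≠ 0 := Nat.cast_ne_zero.mpr (NeZero.ne q)
  calc ∑ c : ZMod (M' * q) × ZMod (M' * q),
        Ψ' (rep (M' * q) c 0) * Φ (rep (M' * q) c 0) * kroneckerE₁ (conj (classDiv (M' * q) c))
      = ∑ p : (ZMod M' × ZMod M') × (ZMod q × ZMod q), Ψ' (rep M' p.1 0) *
          (Φ (rep q p.2 0) * kroneckerE₁ (e * conj ((rep M' p.1 0 : GaussianInt) : ℂ) / M' -
            f * conj ((rep q p.2 0 : GaussianInt) : ℂ) / q)) := by
        refine Fintype.sum_equiv (crtPairEquiv hc) _ _ fun c ↦ ?_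
        rw [crtPairEquiv_apply_fst, crtPairEquiv_apply_snd]
        set x : GaussianInt := rep (M' * q) c 0 with hxdef
        set a : ZMod M' × ZMod M' := ((c.1.val : ZMod M'), (c.2.val : ZMod M')) with hadef
        set b : ZMod q × ZMod q := ((c.1.val : ZMod q), (c.2.val : ZMod q)) with hbdef
        have hclsa : cls M' x = a := by simp [cls, rep, hxdef, hadef]
        have hclsb : cls q x = b := by simp [cls, rep, hxdef, hbdef]
        have e1 : Ψ' x = Ψ' (rep M' a 0) := apply_eq_of_cls_eq M' hΨ (by rw [hclsa, cls_rep])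
        have e2 : Φ x = Φ (rep q b 0) := apply_eq_of_cls_eq q hΦ (by rw [hclsb, cls_rep])
        obtain ⟨y₁, hy₁⟩ := exists_rep_eq M' hclsa
        obtain ⟨y₂, hy₂⟩ := exists_rep_eq q hclsb
        have hxA : (x : ℂ) = (rep M' a 0 : ℂ) + M' * ((⟨y₁.1, y₁.2⟩ : GaussianInt) : ℂ) := by
          rw [← hy₁, rep_eq_rep_zero_add M' a y₁, GaussianInt.toComplex_add, GaussianInt.toComplex_mul, map_natCast]
        have hxB : (x : ℂ) = (rep q b 0 : ℂ) + q * ((⟨y₂.1, y₂.2⟩ : GaussianInt) : ℂ) := by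
          rw [← hy₂, rep_eq_rep_zero_add q b y₂, GaussianInt.toComplex_add, GaussianInt.toComplex_mul, map_natCast]
        have hef' : (q : ℂ) * e - M' * f = 1 := by exact_mod_cast hef
        have hx : (x : ℂ) = q * e * ((rep M' a 0 : ℂ) + M' * ((⟨y₁.1, y₁.2⟩ : GaussianInt) : ℂ)) -
            M' * f * ((rep q b 0 : ℂ) + q * ((⟨y₂.1, y₂.2⟩ : GaussianInt) : ℂ)) := by
          rw [← hxA, ← hxB]; linear_combination -((x : ℂ)) * hef'
        have e3 : kroneckerE₁ (conj (classDiv (M' * q) c)) =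
            kroneckerE₁ (e * conj ((rep M' a 0 : GaussianInt) : ℂ) / M' - f * conj ((rep q b 0 : GaussianInt) : ℂ) / q) := by
          have hl := (ofUpperHalfPlane UpperHalfPlane.I).lattice.sub_mem
            ((ofUpperHalfPlane UpperHalfPlane.I).lattice.smul_mem e (conj_toComplex_mem_lattice ⟨y₁.1, y₁.2⟩))
            ((ofUpperHalfPlane UpperHalfPlane.I).lattice.smul_mem f (conj_toComplex_mem_lattice ⟨y₂.1, y₂.2⟩))
          rw [classDiv_def, ← hxdef, map_div₀, map_natCast, hx,
            show conj (q * e * (((rep M' a 0 : GaussianInt) : ℂ) + M' * ((⟨y₁.1, y₁.2⟩ : GaussianInt) : ℂ)) -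
                M' * f * (((rep q b 0 : GaussianInt) : ℂ) + q * ((⟨y₂.1, y₂.2⟩ : GaussianInt) : ℂ))) / ((M' * q : ℕ) : ℂ) =
              (e * conj ((rep M' a 0 : GaussianInt) : ℂ) / M' - f * conj ((rep q b 0 : GaussianInt) : ℂ) / q) +
                (e • conj (((⟨y₁.1, y₁.2⟩ : GaussianInt) : ℂ)) - f • conj (((⟨y₂.1, y₂.2⟩ : GaussianInt) : ℂ))) by
              simp only [map_sub, map_add, map_mul, map_natCast, map_intCast, zsmul_eq_mul]
              push_cast
              field_simp
              ring,
            kroneckerE₁_add_of_mem _ hl]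
        rw [e1, e2, e3]
        ring
    _ = _ := by
        rw [Fintype.sum_prod_type]
        refine Finset.sum_congr rfl fun a _ ↦ ?_
        rw [Finset.mul_sum]

end CRT

/-! ## §2 Bézout bookkeeping and the finite formula at level `qM′` -/

section FiniteFormula

variable (M' q : ℕ) [NeZero M'] [NeZero q] [NeZero (M' * q)]

omit [NeZero M'] [NeZero q] [NeZero (M' * q)] in
/-- Bézout for `gcd(M′, q) = 1`: integers `e, f` with `q·e − M′·f = 1`. [folklore] -/
theorem exists_mul_sub_mul_eq_one (hc : M'.Coprime q) : ∃ e f : ℤ, q * e - M' * f = 1 := by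
  obtain ⟨a, b, hab⟩ := (Nat.isCoprime_iff_coprime.mpr hc.symm : IsCoprime (q : ℤ) (M' : ℤ))
  refine ⟨a, -b, ?_⟩
  linear_combination hab

omit [NeZero M'] [NeZero q] [NeZero (M' * q)] in
/-- `q·e − M′·f = 1 ⇒ q ∤ f` (for `q > 1`). [folklore] -/
theorem not_dvd_of_bezout (hq : 1 < q) {e f : ℤ} (hef : q * e - M' * f = 1) : ¬ (q : ℤ) ∣ f := by
  rintro ⟨k, rfl⟩
  have hd : (q : ℤ) ∣ 1 := ⟨e - M' * k, by linear_combination -hef⟩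
  have := Int.eq_one_of_dvd_one (Int.natCast_nonneg q) hd
  omega

omit [NeZero M'] [NeZero q] [NeZero (M' * q)] in
/-- `q·e − M′·f = 1 ⇒ (f, q) = 1`. [folklore] -/
theorem isCoprime_of_bezout {e f : ℤ} (hef : q * e - M' * f = 1) : IsCoprime f (q : ℤ) :=
  ⟨-M', e, by linear_combination hef⟩

omit [NeZero M'] [NeZero q] [NeZero (M' * q)] in
/-- A product of an `M′`-periodic and a `q`-periodic coefficient is `qM′`-periodic. [folklore] -/
theorem periodic_mul {Ψ' Φ : GaussianInt → ℂ}
    (hΨ : ∀ x y : GaussianInt, Ψ' (x + M' * y) = Ψ' x) (hΦ : ∀ x y : GaussianInt, Φ (x + q * y) = Φ x) :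
    ∀ x y : GaussianInt, Ψ' (x + ((M' * q : ℕ) : GaussianInt) * y) * Φ (x + ((M' * q : ℕ) : GaussianInt) * y) = Ψ' x * Φ x := by
  intro x y
  rw [show x + ((M' * q : ℕ) : GaussianInt) * y = x + (M' : GaussianInt) * (q * y) by push_cast; ring, hΨ,
    show x + (M' : GaussianInt) * (q * y) = x + q * ((M' : GaussianInt) * y) by ring, hΦ]

/-- ★ **The finite formula split by CRT**: for `Ψ = Ψ′·Φ` (`Ψ′` periodic mod `M′`, `Φ` periodic mod `q`, `gcd(M′,q) = 1`, `q·e − M′·f = 1`),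
`Θ-L_{qM′}(Ψ)(1) = (qM′)⁻¹ Σ_{a mod M′} Ψ′(a) Σ_{b mod q} Φ(b) E₁*(e·ā/M′ − f·b̄/q)`
(`GaussianLattice.thetaLFunction_one_eq_sum_kroneckerE₁` + `sum_classes_crt`). [cite: Rubin1999, Prop. 7.15] -/
theorem thetaLFunction_one_crt (hc : M'.Coprime q) {Ψ' Φ : GaussianInt → ℂ}
    (hΨ : ∀ x y : GaussianInt, Ψ' (x + M' * y) = Ψ' x) (hΦ : ∀ x y : GaussianInt, Φ (x + q * y) = Φ x)
    {e f : ℤ} (hef : q * e - M' * f = 1) :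
    thetaLFunction (M' * q) (fun x ↦ Ψ' x * Φ x) 1 =
      ((M' * q : ℕ) : ℂ)⁻¹ * ∑ a : ZMod M' × ZMod M', Ψ' (rep M' a 0) *
        ∑ b : ZMod q × ZMod q, Φ (rep q b 0) *
          kroneckerE₁ (e * conj ((rep M' a 0 : GaussianInt) : ℂ) / M' - f * conj ((rep q b 0 : GaussianInt) : ℂ) / q) := by
  rw [GaussianLattice.thetaLFunction_one_eq_sum_kroneckerE₁ (M' * q) (fun x ↦ Ψ' x * Φ x) (periodic_mul M' q hΨ hΦ),
    ← sum_classes_crt M' q hc hΨ hΦ hef]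

end FiniteFormula

/-! ## §3 Absorbing the Bézout coefficient: `Σ_b Φ(b)E₁*(w − f·b̄/q) = Σ_b Φ(b)E₁*(w − b̄/q)` when `Φ(f·x) = Φ(x)` -/

section Absorb

variable (q : ℕ) [NeZero q]

/-- ★ **Absorbing the Bézout coefficient.** For `Φ` periodic modulo `q` and invariant under multiplication by an integer `f` prime to `q`
(`Φ(f·x) = Φ(x)` — e.g. `Φ = \overline{(·/q)₄}^k` at an inert prime `q`, where `(f/q)₄ = 1` for rational `f`, Ireland–Rosen Prop. 9.8.4), and any `w`:
`Σ_{b mod q} Φ(b)·E₁*(w − f·b̄/q) = Σ_{b mod q} Φ(b)·E₁*(w − b̄/q)` (re-index by `b ↦ f·b`, a permutation of `(ℤ/q)²` since `f` is a unit mod `q`;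
`f·rep(b) ≡ rep(f·b) (mod q)` and `E₁*` is `Λ`-periodic). [folklore] -/
theorem sum_qClasses_absorb {Φ : GaussianInt → ℂ} (hΦ : ∀ x y : GaussianInt, Φ (x + q * y) = Φ x)
    {f : ℤ} (hf : IsCoprime f (q : ℤ)) (hΦf : ∀ x : GaussianInt, Φ ((f : GaussianInt) * x) = Φ x) (w : ℂ) :
    ∑ b : ZMod q × ZMod q, Φ (rep q b 0) * kroneckerE₁ (w - f * conj ((rep q b 0 : GaussianInt) : ℂ) / q) =
      ∑ b : ZMod q × ZMod q, Φ (rep q b 0) * kroneckerE₁ (w - conj ((rep q b 0 : GaussianInt) : ℂ) / q) := by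
  have hq0 : (q : ℂ) ≠ 0 := Nat.cast_ne_zero.mpr (NeZero.ne q)
  -- `f` is a unit modulo `q`, so `b ↦ f·b` permutes `(ℤ/q)²`
  have hu : IsUnit ((f : ℤ) : ZMod q) := by
    obtain ⟨u, v, huv⟩ := hf
    refine IsUnit.of_mul_eq_one ((u : ℤ) : ZMod q) ?_
    have h := congrArg (fun z : ℤ ↦ (z : ZMod q)) huv
    simp only [Int.cast_add, Int.cast_mul, Int.cast_natCast, ZMod.natCast_self, mul_zero, add_zero, Int.cast_one] at h
    rw [mul_comm]; exact h
  set σ : ZMod q × ZMod q → ZMod q × ZMod q := fun b ↦ (((f : ℤ) : ZMod q) * b.1, ((f : ℤ) : ZMod q) * b.2) with hσ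
  have hσinj : Function.Injective σ := by
    intro b b' h
    simp only [hσ, Prod.mk.injEq] at h
    exact Prod.ext (hu.mul_left_cancel h.1) (hu.mul_left_cancel h.2)
  have hσbij : Function.Bijective σ := Finite.injective_iff_bijective.mp hσinj
  symm
  refine (Fintype.sum_bijective σ hσbij _ _ fun b ↦ ?_).symm
  -- `rep (f·b) = f·rep(b) − q·y` for some `y`
  have hcls : cls q ((f : GaussianInt) * rep q b 0) = σ b := by
    ext <;> simp [hσ, cls, rep]
  obtain ⟨y, hy⟩ := exists_rep_eq q hcls
  have hΦ' : Φ (rep q (σ b) 0) = Φ (rep q b 0) := by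
    rw [← hΦf (rep q b 0)]
    exact apply_eq_of_cls_eq q hΦ (by rw [cls_rep, hcls])
  have hrep : ((rep q (σ b) 0 : GaussianInt) : ℂ) = (f : ℂ) * ((rep q b 0 : GaussianInt) : ℂ) - q * ((⟨y.1, y.2⟩ : GaussianInt) : ℂ) := by
    have h := rep_eq_rep_zero_add q (σ b) y
    rw [hy] at h
    have h' : ((((f : GaussianInt) * rep q b 0 : GaussianInt)) : ℂ) =
        ((rep q (σ b) 0 : GaussianInt) : ℂ) + q * ((⟨y.1, y.2⟩ : GaussianInt) : ℂ) := by
      rw [h, GaussianInt.toComplex_add, GaussianInt.toComplex_mul, map_natCast]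
    rw [GaussianInt.toComplex_mul, map_intCast] at h'
    linear_combination (-1 : ℂ) * h'
  have hl := (ofUpperHalfPlane UpperHalfPlane.I).lattice.smul_mem (1 : ℤ) (conj_toComplex_mem_lattice ⟨y.1, y.2⟩)
  rw [hΦ', hrep, show w - conj ((f : ℂ) * ((rep q b 0 : GaussianInt) : ℂ) - q * ((⟨y.1, y.2⟩ : GaussianInt) : ℂ)) / q =
      (w - f * conj ((rep q b 0 : GaussianInt) : ℂ) / q) + (1 : ℤ) • conj (((⟨y.1, y.2⟩ : GaussianInt) : ℂ)) by
        simp only [map_sub, map_mul, map_natCast, map_intCast, one_zsmul]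
        field_simp
        ring,
    kroneckerE₁_add_of_mem _ hl]

end Absorb

/-! ## §4 The finite formula with clean inner sums -/

section Clean

variable (M' q : ℕ) [NeZero M'] [NeZero q] [NeZero (M' * q)]

/-- ★ **The finite formula at level `qM′`, Bézout coefficient absorbed**: for `Ψ = Ψ′·Φ` with `Ψ′` periodic mod `M′`, `Φ` periodic mod `q`
and invariant under multiplication by integers prime to `q`, `gcd(M′, q) = 1` and `q·e − M′·f = 1`:
`Θ-L_{qM′}(Ψ)(1) = (qM′)⁻¹ Σ_{a mod M′} Ψ′(a) · T_Φ(e·ā/M′)`, `T_Φ(w) := Σ_{b mod q} Φ(b) E₁*(w − b̄/q)` — the `Φ`-twisted `q`-division sums at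
the `M′`-division base points `w_a`. [cite: Rubin1999, Prop. 7.15] -/
theorem thetaLFunction_one_crt_absorb (hc : M'.Coprime q) {Ψ' Φ : GaussianInt → ℂ}
    (hΨ : ∀ x y : GaussianInt, Ψ' (x + M' * y) = Ψ' x) (hΦ : ∀ x y : GaussianInt, Φ (x + q * y) = Φ x)
    (hΦint : ∀ (f : ℤ), IsCoprime f (q : ℤ) → ∀ x : GaussianInt, Φ ((f : GaussianInt) * x) = Φ x)
    {e f : ℤ} (hef : q * e - M' * f = 1) :
    thetaLFunction (M' * q) (fun x ↦ Ψ' x * Φ x) 1 =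
      ((M' * q : ℕ) : ℂ)⁻¹ * ∑ a : ZMod M' × ZMod M', Ψ' (rep M' a 0) *
        ∑ b : ZMod q × ZMod q, Φ (rep q b 0) *
          kroneckerE₁ (e * conj ((rep M' a 0 : GaussianInt) : ℂ) / M' - conj ((rep q b 0 : GaussianInt) : ℂ) / q) := by
  rw [thetaLFunction_one_crt M' q hc hΨ hΦ hef]
  congr 1
  refine Finset.sum_congr rfl fun a _ ↦ ?_
  rw [sum_qClasses_absorb q hΦ (isCoprime_of_bezout M' q hef) (hΦint f (isCoprime_of_bezout M' q hef))]

end Clean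

end Summit.BirchSwinnertonDyer.BirchSwinnertonDyer.Theorems.BiquadraticEisensteinDescentManinDatumSupercuspidalCMInertFiniteFormulaCRT

end
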